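import Summits.AtomisticToContinuum.HydrodynamicLimit.Theorems.CollisionIsometryCLTAdaptedWeightCLTBHCoarseningIntegrated
import Summits.AtomisticToContinuum.HydrodynamicLimit.Theorems.CollisionIsometryCLTAdaptedWeightCLTSAWindowOrbit

/-!
# Stub `stub_coarsening` (S6) of the line `block-h-dissipation-closure` for the crux `AdaptedWeightCLT`
(stmt-AtomisticToContinuum-14868, rev-12 TIME-LOCAL form; `--supports`), helper file: THE GERMANO INEQUALITY
ALONG A GOOD ORBIT, integrated up to the horizon

* `ReynG` — the REYNOLDS PART of the coarsening on `[0, t]`, `∫₀ᵗ ∫ₓ ethG · reyG (Φ_s z, x)` (the ψ-smeared twin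
  of `SustainedAnisotropy.ReynInt`);
* joint measurability of `ethG`, `reyG` in `(w, x)` (parametric integrals of jointly measurable integrands,
  `StronglyMeasurable.integral_prod_right'`), hence in `(s, x)` along a good orbit, where they are bounded
  (velocities `≤ vR z`, `Reduction.norm_vel_flow_le`) and have genuine iterated integrals
  (`Reduction.integrable_of_bdd`);
* `xint_le_orbit` — the time-integrated coarsening inequality on the good set:
  `∫₀ᵗ∫ₓ DefectSq φ ≤ 4 ∫₀ᵗ∫ₓ DefectSq ψ + K_N ∫₀ᵗ (N+1)⁻¹ Σᵢ (1 + |vᵢ(s)|⁶) ds + 1260 · ReynG`,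
  `K_N = 144 ε_N² R_N³ |B₁| · 80`;
* `integral_m6_le` — the sixth moment against the exponential moment of H2
  (`WindowOfUI.avg_one_add_pow_six_le`): `∫₀ᵗ (N+1)⁻¹ Σᵢ (1 + |vᵢ(s)|⁶) ds ≤ 2t + 720 λ⁻⁶ ∫₀ᵗ expMoment λ`.
-/

namespace Summit.AtomisticToContinuum.HydrodynamicLimit.Theorems.BlockHDissipation

open scoped BigOperators Topology Classical MeasureTheory ENNReal InnerProductSpace
open Filter Set MeasureTheory
open Literature.Analysis.FluidPDE Literature.Analysis.FluidPDE.Torus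
open Summit.AtomisticToContinuum.HydrodynamicLimit.Theorems.ContactSourceDuhamel
open Summit.AtomisticToContinuum.HydrodynamicLimit.Theorems.ContactSourceDuhamel.TimeLocal
open Summit.AtomisticToContinuum.HydrodynamicLimit.Theorems.ContactBalance
open Summit.AtomisticToContinuum.HydrodynamicLimit.Theorems.SustainedAnisotropy
open Literature.MathematicalPhysics.KineticTheory (hsDiameter localGibbsLaw empiricalDensityField
  empiricalMomentumField)

noncomputable section

/-- The REYNOLDS PART of the coarsening on `[0, t]`: `∫₀ᵗ ∫ₓ ethG · reyG (Φ_s z, x)` (energy-weighted, ψ-smeared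
sub-block fluctuation of the cell velocities about the block velocities; the twin of
`SustainedAnisotropy.ReynInt` with smeared cell velocities). -/
def ReynG (σ : ℝ) (N : ℕ) (Φ : Flow σ N) (φ ψ : ℕ → T3 → ℝ) (t : ℝ) (z : Cfg N) : ℝ :=
  ∫ s in Icc 0 t, ∫ x, ethG N φ ψ (Φ.flow s z) x * reyG N φ ψ (Φ.flow s z) x

namespace Coarsening

/-! ## Joint measurability of the smeared functionals in `(w, x)` -/

section Meas

variable {N : ℕ} {φ ψ : ℕ → T3 → ℝ}

/-- The building blocks of the smeared integrands are jointly measurable on `(Cfg × 𝕋³) × 𝕋³`. -/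
theorem measurable_blocks (hφc : Continuous (φ N)) (hψc : Continuous (ψ N)) (i : Fin (N + 1)) :
    (Measurable fun p : (Cfg N × T3) × T3 => wgtC N φ p.1.1 p.1.2 i) ∧
    (Measurable fun p : (Cfg N × T3) × T3 => wgtC N ψ p.1.1 p.2 i) ∧
    (Measurable fun p : (Cfg N × T3) × T3 => ubarC N ψ p.1.1 p.2) ∧
    (Measurable fun p : (Cfg N × T3) × T3 => ubarC N φ p.1.1 p.1.2) ∧
    (Measurable fun p : (Cfg N × T3) × T3 => (p.1.1 i).2) :=
  ⟨(EqRung.measurable_wgtC_prod hφc i).comp measurable_fst,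
    (EqRung.measurable_wgtC_prod hψc i).comp ((measurable_fst.comp measurable_fst).prodMk measurable_snd),
    (EqRung.measurable_ubarC_prod hψc).comp ((measurable_fst.comp measurable_fst).prodMk measurable_snd),
    (EqRung.measurable_ubarC_prod hφc).comp measurable_fst,
    (Geometry.IsMeasurable.measurable_vel i).comp (measurable_fst.comp measurable_fst)⟩

/-- `ethG` is jointly measurable in `(w, x)`. -/
theorem measurable_ethG_prod (hφc : Continuous (φ N)) (hψc : Continuous (ψ N)) :
    Measurable fun q : Cfg N × T3 => ethG N φ ψ q.1 q.2 := by
  have hF : Measurable fun p : (Cfg N × T3) × T3 => ((N + 1 : ℕ) : ℝ)⁻¹ * ∑ i : Fin (N + 1),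
      wgtC N φ p.1.1 p.1.2 i * (wgtC N ψ p.1.1 p.2 i *
        (1 + ‖(p.1.1 i).2 - ubarC N ψ p.1.1 p.2‖ ^ 2 + ‖(p.1.1 i).2 - ubarC N ψ p.1.1 p.2‖ ^ 4 +
          ‖ubarC N ψ p.1.1 p.2 - ubarC N φ p.1.1 p.1.2‖ ^ 2)) := by
    refine (Finset.measurable_sum _ fun i _ => ?_).const_mul _
    obtain ⟨h1, h2, h3, h4, h5⟩ := measurable_blocks hφc hψc i
    exact h1.mul (h2.mul (((measurable_const.add ((h5.sub h3).norm.pow_const 2)).add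
      ((h5.sub h3).norm.pow_const 4)).add ((h3.sub h4).norm.pow_const 2)))
  exact (hF.stronglyMeasurable.integral_prod_right' (ν := (volume : Measure T3))).measurable

/-- `reyG` is jointly measurable in `(w, x)`. -/
theorem measurable_reyG_prod (hφc : Continuous (φ N)) (hψc : Continuous (ψ N)) :
    Measurable fun q : Cfg N × T3 => reyG N φ ψ q.1 q.2 := by
  have hF : Measurable fun p : (Cfg N × T3) × T3 => ((N + 1 : ℕ) : ℝ)⁻¹ * ∑ i : Fin (N + 1),
      wgtC N φ p.1.1 p.1.2 i * (wgtC N ψ p.1.1 p.2 i *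
        (‖ubarC N ψ p.1.1 p.2 - ubarC N φ p.1.1 p.1.2‖ ^ 2 + ‖ubarC N ψ p.1.1 p.2 - ubarC N φ p.1.1 p.1.2‖ ^ 4)) := by
    refine (Finset.measurable_sum _ fun i _ => ?_).const_mul _
    obtain ⟨h1, h2, h3, h4, -⟩ := measurable_blocks hφc hψc i
    exact h1.mul (h2.mul (((h3.sub h4).norm.pow_const 2).add ((h3.sub h4).norm.pow_const 4)))
  exact (hF.stronglyMeasurable.integral_prod_right' (ν := (volume : Measure T3))).measurable

end Meas

/-! ## Along a good orbit -/

section Orbit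

variable {σ : ℝ} {N : ℕ} {γ C γc C' : ℝ} {φ ψ : ℕ → T3 → ℝ} (Φ : Flow σ N) {z : Cfg N}

/-- The Reynolds product along a good orbit is jointly measurable in `(s, x)` and bounded on `[0, t] × 𝕋³`. -/
theorem measurable_bdd_ethG_reyG (hadm : AdmissibleKernel γ C φ) (hadmc : AdmissibleKernel γc C' ψ)
    (hz : z ∈ Φ.good) (t : ℝ) :
    (Measurable fun p : ℝ × T3 => ethG N φ ψ (Φ.flow p.1 z) p.2 * reyG N φ ψ (Φ.flow p.1 z) p.2) ∧
      ∃ B, ∀ s ∈ Icc 0 t, ∀ x, |ethG N φ ψ (Φ.flow s z) x * reyG N φ ψ (Φ.flow s z) x| ≤ B := by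
  have hφc : Continuous (φ N) := (hadm.1 N).continuous
  have hψc : Continuous (ψ N) := (hadmc.1 N).continuous
  refine ⟨(ScaleSplit.measurable_orbit hz (F := ethG N φ ψ) (measurable_ethG_prod hφc hψc)).mul
    (ScaleSplit.measurable_orbit hz (F := reyG N φ ψ) (measurable_reyG_prod hφc hψc)), ?_⟩
  have hM : ((N + 1 : ℕ) : ℝ) = (N : ℝ) + 1 := Nat.cast_succ N
  have hE := fun s x => ethG_le_of_vel hψc (hadmc.2.1 N) (hadmc.2.2.1 N) (hadm.2.1 N) (hadm.2.2.2.2.1 N)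
    (Φ.flow s z) x (Reduction.vR_nonneg z) (Reduction.norm_vel_flow_le Φ hz s)
  have hR := fun s x => reyG_le_of_vel hψc (hadmc.2.1 N) (hadmc.2.2.1 N) (hadm.2.1 N) (hadm.2.2.2.2.1 N)
    (Φ.flow s z) x (Reduction.vR_nonneg z) (Reduction.norm_vel_flow_le Φ hz s)
  refine ⟨C * ((N : ℝ) + 1) ^ (3 * γ) * (1 + (2 * Reduction.vR z) ^ 2 + (2 * Reduction.vR z) ^ 4 +
      (2 * Reduction.vR z) ^ 2) * (C * ((N : ℝ) + 1) ^ (3 * γ) * ((2 * Reduction.vR z) ^ 2 +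
        (2 * Reduction.vR z) ^ 4)), fun s _ x => ?_⟩
  rw [abs_mul, abs_of_nonneg (hE s x).1, abs_of_nonneg (hR s x).1]
  exact mul_le_mul (hE s x).2 (hR s x).2 (hR s x).1 ((hE s x).1.trans (hE s x).2)

/-- The sixth velocity moment along a good orbit is measurable in time and bounded. -/
theorem measurable_bdd_m6 (hz : z ∈ Φ.good) :
    (Measurable fun s : ℝ => ((N + 1 : ℕ) : ℝ)⁻¹ * ∑ i : Fin (N + 1), (1 + ‖(Φ.flow s z i).2‖ ^ 6)) ∧
      ∀ s, |((N + 1 : ℕ) : ℝ)⁻¹ * ∑ i : Fin (N + 1), (1 + ‖(Φ.flow s z i).2‖ ^ 6)| ≤ 1 + Reduction.vR z ^ 6 := by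
  refine ⟨(Finset.measurable_sum _ fun i _ => measurable_const.add
    ((((Geometry.IsMeasurable.measurable_vel i).comp (Reduction.measurable_flow_of_mem_good Φ hz)).norm).pow_const
      6)).const_mul _, fun s => ?_⟩
  refine Reduction.abs_avg_le _ fun i => ?_
  rw [abs_of_nonneg (by positivity)]
  linarith [pow_le_pow_left₀ (norm_nonneg _) (Reduction.norm_vel_flow_le Φ hz s i) 6]

/-- **THE COARSENING INEQUALITY ALONG A GOOD ORBIT, INTEGRATED UP TO THE HORIZON**:
`∫₀ᵗ∫ₓ DefectSq φ ≤ 4 ∫₀ᵗ∫ₓ DefectSq ψ + K_N ∫₀ᵗ (N+1)⁻¹ Σᵢ (1 + |vᵢ(s)|⁶) ds + 1260 ReynG`, with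
`K_N = 144 ε_N² R_N³ |B₁| 80`. -/
theorem xint_le_orbit (hadm : AdmissibleKernel γ C φ) (hadmc : AdmissibleKernel γc C' ψ) (hz : z ∈ Φ.good)
    (hR0 : 0 < kvRad γ γc N) (hR : kvRad γ γc N < 1 / 2) (t : ℝ) :
    ∫ s in Icc 0 t, ∫ x, DefectSq σ N Φ φ s z x ≤
      4 * (∫ s in Icc 0 t, ∫ x, DefectSq σ N Φ ψ s z x) +
      144 * (kvLip γ C γc N ^ 2 * (kvRad γ γc N ^ 3 * PastDamping.ballVol * 80)) *
        (∫ s in Icc 0 t, ((N + 1 : ℕ) : ℝ)⁻¹ * ∑ i : Fin (N + 1), (1 + ‖(Φ.flow s z i).2‖ ^ 6)) +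
      1260 * ReynG σ N Φ φ ψ t z := by
  have hM : ((N + 1 : ℕ) : ℝ) = (N : ℝ) + 1 := Nat.cast_succ N
  have hDφ := Reduction.integrable_of_bdd t (fun s x => DefectSq σ N Φ φ s z x)
    (Reduction.measurable_defectSq hz (hadm.1 N).continuous) (Reduction.bdd_defectSq hz (hadm.2.1 N)
      (hadm.2.2.2.2.1 N))
  have hDψ := Reduction.integrable_of_bdd t (fun s x => DefectSq σ N Φ ψ s z x)
    (Reduction.measurable_defectSq hz (hadmc.1 N).continuous) (Reduction.bdd_defectSq hz (hadmc.2.1 N)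
      (hadmc.2.2.2.2.1 N))
  obtain ⟨hmER, hbER⟩ := measurable_bdd_ethG_reyG Φ hadm hadmc hz t
  have hER := Reduction.integrable_of_bdd t (fun s x => ethG N φ ψ (Φ.flow s z) x * reyG N φ ψ (Φ.flow s z) x)
    hmER hbER
  obtain ⟨hm6, hb6⟩ := measurable_bdd_m6 Φ hz
  have hI6 : IntegrableOn (fun s : ℝ => ((N + 1 : ℕ) : ℝ)⁻¹ * ∑ i : Fin (N + 1), (1 + ‖(Φ.flow s z i).2‖ ^ 6))
      (Icc 0 t) :=
    IntegrableOn.of_bound measure_Icc_lt_top hm6.aestronglyMeasurable.restrict (1 + Reduction.vR z ^ 6)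
      (ae_of_all _ fun s => by rw [Real.norm_eq_abs]; exact hb6 s)
  set K := 144 * (kvLip γ C γc N ^ 2 * (kvRad γ γc N ^ 3 * PastDamping.ballVol * 80)) with hK
  -- pointwise in time
  have hpt : ∀ s ∈ Icc 0 t, ∫ x, DefectSq σ N Φ φ s z x ≤
      4 * (∫ x, DefectSq σ N Φ ψ s z x) +
        K * (((N + 1 : ℕ) : ℝ)⁻¹ * ∑ i : Fin (N + 1), (1 + ‖(Φ.flow s z i).2‖ ^ 6)) +
        1260 * ∫ x, ethG N φ ψ (Φ.flow s z) x * reyG N φ ψ (Φ.flow s z) x := fun s hs => by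
    have h := integral_defectC_le_germano hadm hadmc (Φ.flow s z) hR0 hR (hER.1 s hs)
    change ∫ x, defectC N φ (Φ.flow s z) x ≤ 4 * (∫ x', defectC N ψ (Φ.flow s z) x') + _ + _
    refine h.trans (le_of_eq ?_)
    rw [hK]
    ring
  -- integrate in time
  calc ∫ s in Icc 0 t, ∫ x, DefectSq σ N Φ φ s z x
      ≤ ∫ s in Icc 0 t, (4 * (∫ x, DefectSq σ N Φ ψ s z x) +
          K * (((N + 1 : ℕ) : ℝ)⁻¹ * ∑ i : Fin (N + 1), (1 + ‖(Φ.flow s z i).2‖ ^ 6)) +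
          1260 * ∫ x, ethG N φ ψ (Φ.flow s z) x * reyG N φ ψ (Φ.flow s z) x) :=
        setIntegral_mono_on hDφ.2 (((hDψ.2.const_mul 4).add (hI6.const_mul K)).add (hER.2.const_mul 1260))
          measurableSet_Icc hpt
    _ = _ := by
        have hA : IntegrableOn (fun s => 4 * ∫ x, DefectSq σ N Φ ψ s z x) (Icc 0 t) := hDψ.2.const_mul 4
        have hB : IntegrableOn (fun s => K * (((N + 1 : ℕ) : ℝ)⁻¹ * ∑ i : Fin (N + 1),
            (1 + ‖(Φ.flow s z i).2‖ ^ 6))) (Icc 0 t) := hI6.const_mul K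
        have hCi : IntegrableOn (fun s => 1260 * ∫ x, ethG N φ ψ (Φ.flow s z) x * reyG N φ ψ (Φ.flow s z) x)
            (Icc 0 t) := hER.2.const_mul 1260
        have hAB : IntegrableOn (fun s => 4 * (∫ x, DefectSq σ N Φ ψ s z x) +
            K * (((N + 1 : ℕ) : ℝ)⁻¹ * ∑ i : Fin (N + 1), (1 + ‖(Φ.flow s z i).2‖ ^ 6))) (Icc 0 t) := hA.add hB
        rw [integral_add hAB hCi, integral_add hA hB, integral_const_mul 4, integral_const_mul K,
          integral_const_mul 1260]
        rfl

/-- **The sixth moment against the exponential moment** along a good orbit (`λ > 0`, `t ≥ 0`):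
`∫₀ᵗ (N+1)⁻¹ Σᵢ (1 + |vᵢ(s)|⁶) ds ≤ 2t + 720 λ⁻⁶ ∫₀ᵗ expMoment λ (Φ_s z) ds`. -/
theorem integral_m6_le (hz : z ∈ Φ.good) {lam : ℝ} (hlam : 0 < lam) {t : ℝ} (ht : 0 ≤ t) :
    ∫ s in Icc 0 t, ((N + 1 : ℕ) : ℝ)⁻¹ * ∑ i : Fin (N + 1), (1 + ‖(Φ.flow s z i).2‖ ^ 6) ≤
      2 * t + 720 / lam ^ 6 * ∫ s in Icc 0 t, PastDamping.expMoment lam N (Φ.flow s z) := by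
  obtain ⟨hm6, hb6⟩ := measurable_bdd_m6 Φ hz
  have hI6 : IntegrableOn (fun s : ℝ => ((N + 1 : ℕ) : ℝ)⁻¹ * ∑ i : Fin (N + 1), (1 + ‖(Φ.flow s z i).2‖ ^ 6))
      (Icc 0 t) :=
    IntegrableOn.of_bound measure_Icc_lt_top hm6.aestronglyMeasurable.restrict (1 + Reduction.vR z ^ 6)
      (ae_of_all _ fun s => by rw [Real.norm_eq_abs]; exact hb6 s)
  have hIE := PastDamping.integrableOn_expMoment_flow hlam.le Φ hz 0 t
  have hpt : ∀ s ∈ Icc 0 t, ((N + 1 : ℕ) : ℝ)⁻¹ * ∑ i : Fin (N + 1), (1 + ‖(Φ.flow s z i).2‖ ^ 6) ≤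
      2 + 720 / lam ^ 6 * PastDamping.expMoment lam N (Φ.flow s z) := fun s _ => by
    have h := WindowOfUI.avg_one_add_pow_six_le hlam one_pos (Φ.flow s z)
    have e : (((6 : ℕ).factorial : ℕ) : ℝ) / (lam * 1) ^ 6 = 720 / lam ^ 6 := by norm_num [Nat.factorial]
    rw [e] at h
    linarith
  have hc2 : IntegrableOn (fun _ : ℝ => (2 : ℝ)) (Icc 0 t) := integrableOn_const measure_Icc_lt_top.ne
  have hcE : IntegrableOn (fun s => 720 / lam ^ 6 * PastDamping.expMoment lam N (Φ.flow s z)) (Icc 0 t) :=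
    hIE.const_mul _
  calc _ ≤ ∫ s in Icc 0 t, (2 + 720 / lam ^ 6 * PastDamping.expMoment lam N (Φ.flow s z)) :=
        setIntegral_mono_on hI6 (hc2.add hcE) measurableSet_Icc hpt
    _ = 2 * t + 720 / lam ^ 6 * ∫ s in Icc 0 t, PastDamping.expMoment lam N (Φ.flow s z) := by
        rw [integral_add hc2 hcE, integral_const_mul, setIntegral_const, smul_eq_mul, measureReal_def,
          Real.volume_Icc, sub_zero, ENNReal.toReal_ofReal ht]
        ring

end Orbit

end Coarsening

/-- Registered anchor of this helper file (`--supports stmt-AtomisticToContinuum-14868`): the sixth velocity moment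
along a good orbit against the exponential moment of H2 (`Coarsening.integral_m6_le`). -/
theorem bhCoarsening_orbit_anchor : ∀ (σ : ℝ) (N : ℕ) (Φ : Flow σ N) (z : Cfg N), z ∈ Φ.good → ∀ (lam t : ℝ), 0 < lam → 0 ≤ t → ∫ s in Icc 0 t, ((N + 1 : ℕ) : ℝ)⁻¹ * ∑ i : Fin (N + 1), (1 + ‖(Φ.flow s z i).2‖ ^ 6) ≤ 2 * t + 720 / lam ^ 6 * ∫ s in Icc 0 t, PastDamping.expMoment lam N (Φ.flow s z) :=
  fun _ _ Φ _ hz _ _ hlam ht => Coarsening.integral_m6_le Φ hz hlam ht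

end

end Summit.AtomisticToContinuum.HydrodynamicLimit.Theorems.BlockHDissipation
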